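import Summits.QuantumFields.YangMills.Theorems.BalabanUVNodesK0RecordFormatNamesFluctRatioC
import Summits.QuantumFields.YangMills.Theorems.BalabanUVNodesK0RecordFormatNamesFluctInt

/-!
# NODE O port PT-A — FE-1's chart law (T1), brick (B-γ1′): «THE REMAINING VARIABLES `B`» ([I] p.268) AS A CARRIER — DEF-1's flat coordinates `y : NonB0Idx F k K → ℝ` off the central bonds
# read as the 𝔤-valued field `(b ∉ b₀(𝔅)) ↦ ℝ³`, a LEBESGUE-PRESERVING measurable equivalence `fluctVecRem`, and the transport of reduced chart integrals onto DEF-1's carrier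

Cell `ym-nodeO-ideate`, porter seat PT-A-1 (gen 10); `--supports stmt-QuantumFields-27930 --as helper`; count-neutral.  [I] = [Balaban1987RG1]; [16] = [Balaban1985UV3].
Sequel of ✓`…PortS1ChartJacobianRecord` (`fluctVec`, the all-bonds edition) for the sub-product that survives the dummy-coordinate reduction (brick (B-γ1), `…PortS1ChartDummy`): after the central bond
variables are integrated out, (2.10) leaves an integral over `A′ : {b // b ∉ range b₀} → ℝ³`; DEF-1's (2.12)∕(2.13) objects (`recordRem`, `chiRem`, `recordCopFluct`, the Gaussian `gaussFieldPush (recordCopκ …)`)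
live on `NonB0Idx F k K → ℝ` (`NonB0Idx = {i : bonds × Fin 3 // i.1 ∉ range b₀}`, ✓`…FluctE` :43).  This file is the dictionary between the two.

WHAT IS PROVED.
* §1 def `fluctVecRem F k K : (NonB0Idx F k K → ℝ) ≃ᵐ ({b // b ∉ range (recordB0 F k K)} → EuclideanSpace ℝ (Fin 3))` (re-indexing `NonB0Idx ≃ {b ∉ b₀} × Fin 3`, currying, `toLp 2`); faces `fluctVecRem_apply`
  (`(fluctVecRem y b) a = y ⟨(b, a), _⟩`, `rfl`), `fluctVecRem_symm_apply`, ★ `measurePreserving_fluctVecRem` (Lebesgue ↦ Lebesgue), `norm_fluctVecRem_apply`, `fluctVecRem_preimage_pi_ball` (the window is DEF-1's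
  `chiRem` condition `∀ b ∉ b₀, √(Σ_a y(b,a)²) < s`), `measurableSet_remWindow`, `fluctVecRem_recordRem` (`fluctVecRem (recordRem x) = (fluctVec x)|_{b ∉ b₀}`), `fluctSigma_fluctVecRem_eq` (sinc form).
* §2 ★★ `setIntegral_pi_ball_eq_setIntegral_remWindow` — `∫_{|A′_b|<s, b∉b₀} h(A′) dA′ = ∫_{{y : ∀ b ∉ b₀, √(Σ_a y(b,a)²) < s}} h(fluctVecRem y) dy` for EVERY `h` (no measurability: measure-preserving
  equivalence), and its `lintegral` twin; `chiRem_eq_indicator_remWindow` (DEF-1's cut-off IS the indicator of that window).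

HONEST FRAMING.  Coordinate bookkeeping (one measurable equivalence and its faces); nothing of Bałaban's (2.10)–(2.14) asserted; the use ((B-★) assembly of the chart law) is NOT here;
`FEChartLawStep`∕`FEStepBox` inhabited nowhere; `stub_P0C`∕`stub_FEstep` OPEN; ⟨27930⟩ OPEN 1∕3; NODE O 0∕1; COUNT 8∕28 · K 1∕4 UNMOVED; finite `𝕋⁴_{L^K}` at fixed ε — NOT continuum ∕ OS;
**the Yang–Mills mass gap (Clay) is NOT proved by any of this.**  One `def` (a measurable equivalence, no junk), no `instance`, no `sorry`; standard axioms only.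
-/

noncomputable section

open MeasureTheory MeasureTheory.Measure Set Metric
open scoped ENNReal BigOperators

namespace Summit.QuantumFields.YangMills.Theorems.BalabanUVNodesPortS1

open Literature.MathematicalPhysics.QuantumFieldTheory.Balaban1983to89
open Literature.MathematicalPhysics.QuantumFieldTheory.Balaban1983to89.Node00
open Literature.MathematicalPhysics.QuantumFieldTheory.Balaban1983to89.T4Continuum (T4Family)
open Summit.QuantumFields.YangMills.Theorems.K0RecordFormatNames (FluctIdx NonB0Idx recordB0 recordRem chiRem)

variable (F : T4Family)

/-! ## §1  The remaining variables as a 𝔤-valued field off the central bonds -/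

section Carrier

/-- ★ **«THE REMAINING VARIABLES `B`» READ AS A FIELD `(b ∉ b₀(𝔅)) ↦ ℝ³`**: DEF-1's flat coordinates `y : NonB0Idx F k K → ℝ` re-indexed along `NonB0Idx ≃ {b // b ∉ range b₀} × Fin 3`
(`Equiv.prodSubtypeFstEquivSubtypeProd`), curried, and read in the Euclidean structure of each `ℝ³` — a measurable equivalence. [cite: Balaban1987RG1, p.268 («Denoting the remaining variables by B»), (2.4) p.266] -/
def fluctVecRem (k K : ℕ) : (NonB0Idx F k K → ℝ) ≃ᵐ ({b : PBond (F.P K) k // b ∉ Set.range (recordB0 F k K)} → EuclideanSpace ℝ (Fin 3)) :=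
  ((MeasurableEquiv.piCongrLeft (fun _ : {b : PBond (F.P K) k // b ∉ Set.range (recordB0 F k K)} × Fin 3 => ℝ)
      (@Equiv.prodSubtypeFstEquivSubtypeProd (PBond (F.P K) k) (Fin 3) (fun b => b ∉ Set.range (recordB0 F k K)))).trans
    (MeasurableEquiv.curry {b : PBond (F.P K) k // b ∉ Set.range (recordB0 F k K)} (Fin 3) ℝ)).trans
    (MeasurableEquiv.piCongrRight fun _ => MeasurableEquiv.toLp 2 (Fin 3 → ℝ))

/-- Coordinates: `(fluctVecRem y b) a = y ⟨(b, a), b.2⟩`. [cite: Balaban1987RG1, p.268] -/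
@[simp] theorem fluctVecRem_apply (k K : ℕ) (y : NonB0Idx F k K → ℝ) (b : {b : PBond (F.P K) k // b ∉ Set.range (recordB0 F k K)}) (a : Fin 3) :
    fluctVecRem F k K y b a = y ⟨(b.1, a), b.2⟩ := rfl

/-- The bond vector is `toLp 2 (a ↦ y ⟨(b, a), _⟩)`. [folklore] -/
theorem fluctVecRem_apply_eq_toLp (k K : ℕ) (y : NonB0Idx F k K → ℝ) (b : {b : PBond (F.P K) k // b ∉ Set.range (recordB0 F k K)}) :
    fluctVecRem F k K y b = WithLp.toLp 2 (fun a => y ⟨(b.1, a), b.2⟩) := rfl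

/-- The inverse reading: `(fluctVecRem.symm A′) i = (A′ ⟨i.1.1, i.2⟩) i.1.2`. [cite: Balaban1987RG1, p.268] -/
@[simp] theorem fluctVecRem_symm_apply (k K : ℕ) (A' : {b : PBond (F.P K) k // b ∉ Set.range (recordB0 F k K)} → EuclideanSpace ℝ (Fin 3)) (i : NonB0Idx F k K) :
    (fluctVecRem F k K).symm A' i = A' ⟨i.1.1, i.2⟩ i.1.2 := rfl

/-- ★ **`fluctVecRem` PRESERVES LEBESGUE MEASURE** (re-indexing, currying and `toLp 2` all do). [folklore] -/
theorem measurePreserving_fluctVecRem (k K : ℕ) : MeasurePreserving (fluctVecRem F k K) volume volume :=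
  ((volume_measurePreserving_piCongrLeft (fun _ : {b : PBond (F.P K) k // b ∉ Set.range (recordB0 F k K)} × Fin 3 => ℝ)
      (@Equiv.prodSubtypeFstEquivSubtypeProd (PBond (F.P K) k) (Fin 3) (fun b => b ∉ Set.range (recordB0 F k K)))).trans
    ((measurePreserving_uncurry {b : PBond (F.P K) k // b ∉ Set.range (recordB0 F k K)} (Fin 3)).symm _)).trans
    (volume_preserving_pi fun _ : {b : PBond (F.P K) k // b ∉ Set.range (recordB0 F k K)} => PiLp.volume_preserving_toLp (Fin 3))

/-- `|A′(b)| = √(Σ_a y(b,a)²)`. [cite: Balaban1987RG1, (2.9) p.266] -/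
theorem norm_fluctVecRem_apply (k K : ℕ) (y : NonB0Idx F k K → ℝ) (b : {b : PBond (F.P K) k // b ∉ Set.range (recordB0 F k K)}) :
    ‖fluctVecRem F k K y b‖ = √(∑ a : Fin 3, y ⟨(b.1, a), b.2⟩ ^ 2) := by
  rw [EuclideanSpace.norm_eq]
  congr 1
  exact Finset.sum_congr rfl fun a _ => by rw [fluctVecRem_apply, Real.norm_eq_abs, sq_abs]

/-- The reduced flat window is DEF-1's `chiRem` condition: `fluctVecRem⁻¹(Π_b B_s) = {y : ∀ b ∉ b₀, √(Σ_a y(b,a)²) < s}`. [cite: Balaban1987RG1, (2.9) p.266, p.268] -/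
theorem fluctVecRem_preimage_pi_ball (k K : ℕ) (s : ℝ) :
    fluctVecRem F k K ⁻¹' Set.pi univ (fun _ => ball (0 : EuclideanSpace ℝ (Fin 3)) s) =
      {y | ∀ (b : PBond (F.P K) k) (hb : b ∉ Set.range (recordB0 F k K)), √(∑ a : Fin 3, y ⟨(b, a), hb⟩ ^ 2) < s} := by
  ext y
  simp only [mem_preimage, mem_univ_pi, mem_ball_zero_iff, norm_fluctVecRem_apply, mem_setOf_eq, Subtype.forall]

/-- The reduced flat window is Borel. [folklore] -/
theorem measurableSet_remWindow (k K : ℕ) (s : ℝ) :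
    MeasurableSet {y : NonB0Idx F k K → ℝ | ∀ (b : PBond (F.P K) k) (hb : b ∉ Set.range (recordB0 F k K)), √(∑ a : Fin 3, y ⟨(b, a), hb⟩ ^ 2) < s} := by
  rw [← fluctVecRem_preimage_pi_ball]
  exact (fluctVecRem F k K).measurable (MeasurableSet.univ_pi fun _ => measurableSet_ball)

/-- Consistency with the all-bonds reading: `fluctVecRem (recordRem x) = (fluctVec x)|_{b ∉ b₀}`. [cite: Balaban1987RG1, p.268 (bookkeeping)] -/
theorem fluctVecRem_recordRem (k K : ℕ) (x : FluctIdx F k K → ℝ) :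
    fluctVecRem F k K (recordRem F k x) = fun b => fluctVec F k K x b.1 := rfl

/-- The surviving Jacobian in closed form: `σ(fluctVecRem y) = Π_{b ∉ b₀} (sin|y_b|∕|y_b|)²`. [cite: Balaban1987RG1, (2.10) p.267, (2.12) p.268] -/
theorem fluctSigma_fluctVecRem_eq (k K : ℕ) (y : NonB0Idx F k K → ℝ) :
    fluctSigma (fluctVecRem F k K y) = ∏ b : {b : PBond (F.P K) k // b ∉ Set.range (recordB0 F k K)}, Real.sinc (√(∑ a : Fin 3, y ⟨(b.1, a), b.2⟩ ^ 2)) ^ 2 := by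
  unfold fluctSigma
  exact Finset.prod_congr rfl fun b _ => by rw [chartJac_eq_sinc_sq, norm_fluctVecRem_apply]

end Carrier

/-! ## §2  Transport of the reduced chart integrals onto DEF-1's carrier -/

section Transport

/-- ★★ **THE REDUCED FLAT INTEGRAL ON DEF-1's CARRIER** (every integrand, no measurability): `∫_{|A′_b|<s, b∉b₀} h(A′) dA′ = ∫_{{y : ∀ b ∉ b₀, √(Σ_a y(b,a)²) < s}} h(fluctVecRem y) dy`.
[cite: Balaban1987RG1, (2.10) p.267, (2.12)–(2.13) p.268] -/
theorem setIntegral_pi_ball_eq_setIntegral_remWindow {G : Type*} [NormedAddCommGroup G] [NormedSpace ℝ G] (k K : ℕ) (s : ℝ)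
    (h : ({b : PBond (F.P K) k // b ∉ Set.range (recordB0 F k K)} → EuclideanSpace ℝ (Fin 3)) → G) :
    ∫ A' in Set.pi univ (fun _ => ball (0 : EuclideanSpace ℝ (Fin 3)) s), h A' =
      ∫ y in {y : NonB0Idx F k K → ℝ | ∀ (b : PBond (F.P K) k) (hb : b ∉ Set.range (recordB0 F k K)), √(∑ a : Fin 3, y ⟨(b, a), hb⟩ ^ 2) < s}, h (fluctVecRem F k K y) := by
  rw [← (measurePreserving_fluctVecRem F k K).setIntegral_preimage_emb (fluctVecRem F k K).measurableEmbedding h (Set.pi univ fun _ => ball (0 : EuclideanSpace ℝ (Fin 3)) s),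
    fluctVecRem_preimage_pi_ball]

/-- The `lintegral` twin. [cite: Balaban1987RG1, (2.10) p.267] -/
theorem setLIntegral_pi_ball_eq_setLIntegral_remWindow (k K : ℕ) (s : ℝ) (h : ({b : PBond (F.P K) k // b ∉ Set.range (recordB0 F k K)} → EuclideanSpace ℝ (Fin 3)) → ℝ≥0∞) :
    ∫⁻ A' in Set.pi univ (fun _ => ball (0 : EuclideanSpace ℝ (Fin 3)) s), h A' =
      ∫⁻ y in {y : NonB0Idx F k K → ℝ | ∀ (b : PBond (F.P K) k) (hb : b ∉ Set.range (recordB0 F k K)), √(∑ a : Fin 3, y ⟨(b, a), hb⟩ ^ 2) < s}, h (fluctVecRem F k K y) := by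
  rw [← (measurePreserving_fluctVecRem F k K).setLIntegral_comp_preimage_emb (fluctVecRem F k K).measurableEmbedding h (Set.pi univ fun _ => ball (0 : EuclideanSpace ℝ (Fin 3)) s),
    fluctVecRem_preimage_pi_ball]

open Classical in
/-- DEF-1's (2.9) cut-off on the remaining variables IS the indicator of the reduced window: `chiRem F k K ε₁ = 𝟙_{{y : ∀ b ∉ b₀, √(Σ_a y(b,a)²) < ε₁}}`. [cite: Balaban1987RG1, (2.9) p.266, p.268] -/
theorem chiRem_eq_indicator_remWindow (k K : ℕ) (ε₁ : ℝ) (y : NonB0Idx F k K → ℝ) :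
    chiRem F k K ε₁ y = Set.indicator {y : NonB0Idx F k K → ℝ | ∀ (b : PBond (F.P K) k) (hb : b ∉ Set.range (recordB0 F k K)), √(∑ a : Fin 3, y ⟨(b, a), hb⟩ ^ 2) < ε₁}
      (fun _ => (1 : ℝ)) y := by
  unfold chiRem
  simp only [Set.indicator_apply, Set.mem_setOf_eq]

/-- Hence `∫ χ_rem · h dy = ∫_{window} h dy` (the cut-off as a domain of integration). [cite: Balaban1987RG1, (2.9) p.266, (2.13) p.268] -/
theorem integral_chiRem_smul_eq_setIntegral {G : Type*} [NormedAddCommGroup G] [NormedSpace ℝ G] (k K : ℕ) (ε₁ : ℝ) (h : (NonB0Idx F k K → ℝ) → G) :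
    ∫ y, chiRem F k K ε₁ y • h y =
      ∫ y in {y : NonB0Idx F k K → ℝ | ∀ (b : PBond (F.P K) k) (hb : b ∉ Set.range (recordB0 F k K)), √(∑ a : Fin 3, y ⟨(b, a), hb⟩ ^ 2) < ε₁}, h y := by
  rw [← integral_indicator (measurableSet_remWindow F k K ε₁)]
  congr 1
  funext y
  rw [chiRem_eq_indicator_remWindow]
  by_cases hy : y ∈ {y : NonB0Idx F k K → ℝ | ∀ (b : PBond (F.P K) k) (hb : b ∉ Set.range (recordB0 F k K)), √(∑ a : Fin 3, y ⟨(b, a), hb⟩ ^ 2) < ε₁}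
  · rw [Set.indicator_of_mem hy, Set.indicator_of_mem hy, one_smul]
  · rw [Set.indicator_of_notMem hy, Set.indicator_of_notMem hy, zero_smul]

end Transport

end Summit.QuantumFields.YangMills.Theorems.BalabanUVNodesPortS1

end
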